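import Summits.CriticalPhenomena.Ising3DConformalLimit.Theses.PrecisionLaplacian

/-!
# Line `pick-half-strip-entire-profile` — checked skeleton for the crux
`PrecisionLaplacian.StableConeRPRigidity` (stmt-CriticalPhenomena-4800), crux-plan round 1

Crux (fixed, by name): a positive continuous kernel `K` on `ℝ³ ∖ 0`, homogeneous of degree `α - 3`
(`1 ≤ α < 2`), potential kernel of the symmetric `α`-stable generator with even angular Lévy density
`Φ ≥ 0`, `Φ ≢ 0`, invariant and reflection positive in the nine lattice mirrors `eᵢ, eᵢ ± eⱼ`, is
`O(3)`-invariant.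

LINE (symbol side; idea card `Ideas/pick-half-strip-entire-profile.md`, sharpened by TRIAGE r1-1/2/3 and
by the standing disprover's `Disproof.lean` §R/§G/§L/§V).  Everything is moved to the Lévy exponent
`ψ_Φ(k) = ∫ (1 - cos k·z) ‖z‖^(-3-α) Φ(ẑ) dz` (homogeneous of degree `α`, `K̂ = 1/ψ_Φ`):

* `stub_symbolDictionary` (Disproof §R (R1); the heavy import): under the crux hypotheses `ψ_Φ` is
  continuous, positive off `0`, `α`-homogeneous, inherits every mirror invariance of `K`, and — THE
  dictionary — `RP_n(K)` makes every section `s ↦ ψ_Φ(√s·n + ξ)`, `ξ ⊥ n`, a complete Bernstein function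
  (Pick continuation to `ℂ ∖ (-∞,0]`).
* `stub_coordinateCircleConstancy` (THE LEVER of the card = THEOREM A on one coordinate circle =
  Disproof §L = planar rigidity §P(iv)): the `cot²` substitution turns the two Pick sections based at the
  traces `e₀` and `e₀ + e₁` of the circle `{k₂ = 0}` into holomorphy of the angular profile on two
  families of vertical strips of width `π/2` offset by `π/4`; together they make the profile ENTIRE,
  `π`-periodic, of exponential type `≤ 2 + α < 4` (Nevanlinna bound), so only the modes `1, e^{±2iχ}`
  survive and the swap `e₀ ↔ e₁` kills `cos 2χ`: `ψ_Φ` is constant on the unit circle of `{k₂ = 0}`.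
* `stub_jointAnalyticity` (card `cross-theorem-analyticity`, folded in as the local rung by all three
  triagers; Disproof §G "LOCAL step is fine"): nine families of Pick sections ⇒ `ψ_Φ ∈ C^ω(ℝ³ ∖ 0)`.
* `stub_transversalJetFlatness` (THE CLOSER = the residual bet; Disproof §V worked it to second order):
  all transversal jets of `ψ_Φ` across the circle `{k₂ = 0}` are constant along the circle.
* `stub_radialOfFlatJets` (the finish; elementary given analyticity): flat jets + the swap mirror
  `e₀ ↔ e₂` + homogeneity ⇒ `ψ_Φ = c‖k‖^α`, i.e. `ψ_Φ` is `O(3)`-invariant.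
* `stub_kernelIsotropyOfRadialSymbol` (Disproof §0 uniqueness `K = 𝓕⁻¹[1/ψ_Φ]`): a radial symbol has a
  radial potential kernel.

`StableConeRPRigidity_of` composes the six stubs into the crux BY NAME (pure logic: the crux hypotheses
feed the dictionary, its outputs feed the four analytic stubs in a chain, the last output feeds the
converse dictionary).

Disproof.lean honoured: `not_invarianceOnlyRigidity` (RP is load-bearing) — RP enters through the Pick
sections of `stub_symbolDictionary`, consumed by `stub_coordinateCircleConstancy`,
`stub_jointAnalyticity` and `stub_transversalJetFlatness`; §W/§T(2) (the six DIAGONAL mirrors are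
load-bearing) — the lever needs the second, non-perpendicular trace `e₀ + e₁` and the finish needs the
swap `e₀ - e₂`; §W (`α < 2` essential, `1 ≤ α` unused) — `α < 2` is the mode count `2 + α < 4` of the
lever and the phase-sweep window of §V; §G (no tube/Hartogs engine off the fins) — the card's Φ-free
envelope-of-holomorphy transfer C⁺ is NOT a stub: the closer is the jet statement at the seven-circle net
recommended by §P(iii)/§V and by all three triagers, with `Φ ≥ 0` kept available as the reserve input;
§T (no finitely generated counterexample) — consistent, nothing assumed.  No stub is an instance of a
landed Negative lemma (none has landed for this crux: `Theorems/StableConeRPRigidity/Negative/` is empty).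

Shape (D-0027 §3.3, as in `Lines/balanced-split-concavity-transfer`): each stub is a sorried theorem
`Holds.stub_<name> : <full statement> := by sorry` (registered by `ledger skeleton check` under
`stub_<name>` with that text as signature) plus the by-name handle
`def stub_<name> : Prop := type_of% Holds.stub_<name>` required of the hypotheses of
`StableConeRPRigidity_of` by `#h21_check_skeleton`.  Every statement is self-contained over Mathlib:
the symbol is introduced by a defining equation `ψ = fun k => ∫ z, (1 - cos ⟪k,z⟫) ‖z‖^(-(3+α)) Φ(‖z‖⁻¹ z)`,
and the crux's own binders are carried verbatim.
-/

set_option linter.unusedVariables false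

noncomputable section

open scoped BigOperators Topology InnerProductSpace
open MeasureTheory

namespace Summit.CriticalPhenomena.Ising3DConformalLimit.Cruxes.StableConeRPRigidity.PickHalfStripEntireProfile

open Summit.CriticalPhenomena.Ising3DConformalLimit.Theses

/-! ## §1 Registered stubs -/

/-- **stub_symbolDictionary** (size XL; the Fourier dictionary, Disproof §R (R1) + §0).  Under the crux
hypotheses on `(α, Φ, K)` (continuity, positivity, homogeneity of degree `α - 3`, the Fourier-free
potential equation `K ∗ L_Φ f = -f`), the Lévy exponent
`ψ(k) = ∫ (1 - cos ⟪k,z⟫) ‖z‖^(-(3+α)) Φ(‖z‖⁻¹z) dz` is (a) continuous, (b) positive off the origin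
(`Φ ≢ 0`), (c) homogeneous of degree `α` (substitute `z ↦ z/c`), and (d) for EVERY vector `n`:
mirror-invariance of `K` in `n⊥` passes to `ψ` (because `K̂ = 1/ψ` determines `ψ`), and invariance +
reflection positivity of `K` in `n⊥` make every section `s ↦ ψ(√s·n + ξ)`, `ξ ⊥ n`, a complete
Bernstein function: it has a holomorphic continuation `F` to `ℂ ∖ (-∞,0]` with `Im F ≥ 0` on the upper
half-plane (OS/Bernstein–Widder: `K(tn̂ + x') = ∫∫ e^{-λt + iq·x'} dμ`, `μ ≥ 0` ⇒ sections of `K̂ = 1/ψ`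
are Stieltjes ⇒ sections of `ψ` are CBF, SchillingSongVondracek2012 Thm 6.2/7.3; BergChristensenRessel1984
Thm 4.2.8-type representation on `(0,∞) × ℝ²`; FILS78).  `n = 0` is harmless (reflection = id, sections
constant).  Why it might be hard: `K̂ = 1/ψ_Φ` as tempered distributions for a homogeneous kernel of degree
`α - 3` (Mathlib has the Schwartz-space Fourier transform; the tree has
`Literature.Analysis.Distribution.FourierSupportAtZero*`, `Literature.Analysis.Complex.nevanlinna_representation_holds`,
`BochnerTubeFourier`).  Shares its engine (`K̂ = 1/ψ_Φ`) with `stub_kernelIsotropyOfRadialSymbol`. -/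
theorem Holds.stub_symbolDictionary :
    ∀ (α : ℝ) (Φ K ψ : EuclideanSpace ℝ (Fin 3) → ℝ),
    ψ = (fun k => ∫ z, (1 - Real.cos (inner ℝ k z)) * (‖z‖ ^ (-(3 + α)) * Φ (‖z‖⁻¹ • z))) →
    1 ≤ α → α < 2 → ContinuousOn Φ (Metric.sphere 0 1) →
    (∀ u ∈ Metric.sphere (0 : EuclideanSpace ℝ (Fin 3)) 1, 0 ≤ Φ u) →
    (∃ u ∈ Metric.sphere (0 : EuclideanSpace ℝ (Fin 3)) 1, 0 < Φ u) → (∀ u, Φ (-u) = Φ u) →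
    ContinuousOn K {0}ᶜ → (∀ x, x ≠ 0 → 0 < K x) →
    (∀ c : ℝ, 0 < c → ∀ x, K (c • x) = c ^ (α - 3) * K x) →
    (∀ f : EuclideanSpace ℝ (Fin 3) → ℝ, ContDiff ℝ 2 f → HasCompactSupport f → ∀ x,
      (∫ y, K (x - y) * ((1/2 : ℝ) * ∫ z, (f (y + z) + f (y - z) - 2 * f y) *
        (‖z‖ ^ (-(3 + α)) * Φ (‖z‖⁻¹ • z)))) = - f x) →
    Continuous ψ ∧ (∀ k, k ≠ 0 → 0 < ψ k) ∧ (∀ c : ℝ, 0 < c → ∀ k, ψ (c • k) = c ^ α * ψ k) ∧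
    ∀ n : EuclideanSpace ℝ (Fin 3), (∀ x, K (((ℝ ∙ n)ᗮ).reflection x) = K x) →
      (∀ (m : ℕ) (p : Fin m → EuclideanSpace ℝ (Fin 3)) (c : Fin m → ℝ), (∀ a, 0 < inner ℝ (p a) n) →
        0 ≤ ∑ a, ∑ b, c a * c b * K (p a - ((ℝ ∙ n)ᗮ).reflection (p b))) →
      (∀ k, ψ (((ℝ ∙ n)ᗮ).reflection k) = ψ k) ∧
      ∀ ξ : EuclideanSpace ℝ (Fin 3), inner ℝ ξ n = 0 → ∃ F : ℂ → ℂ,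
        DifferentiableOn ℂ F Complex.slitPlane ∧ (∀ z : ℂ, 0 < z.im → 0 ≤ (F z).im) ∧
        ∀ s : ℝ, 0 < s → F (s : ℂ) = ((ψ (Real.sqrt s • n + ξ) : ℝ) : ℂ) := by
  sorry

/-- **stub_coordinateCircleConstancy** (size L; THE LEVER — THEOREM A of the card on the coordinate circle
`{k₂ = 0}`; = Disproof §L seven-plane lemma restricted to one plane = planar rigidity §P(iv); first
lemma `TwoTraceProfileRigidity` of `SketchIdeator3.lean`, triage r1-1/2/3: "clean, true, provable now").
For the symbol `ψ` (continuous, positive, `α`-homogeneous, nine-mirror invariant, nine families of Pick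
sections) put `p(χ) := ψ(cos χ·e₀ + sin χ·e₁)`: `π`-periodic (evenness = three coordinate mirrors), even
(mirror `e₁`), even about `π/4` (swap `e₀ ↔ e₁` = mirror `e₀ - e₁`), continuous.  The Pick section at
(`n = e₀`, `ξ = e₁`) is `F₀(s) = (1+s)^{α/2} p(arccot √s)`; `s = cot² χ` maps the strip `0 < Re χ < π/2`
onto `ℂ ∖ (-∞,0]` (`Re cot(x+iy) = sin 2x/(cosh 2y - cos 2x) > 0`), so
`P := (1 + cot²χ)^{-α/2} F₀(cot²χ)` is a holomorphic extension of `p` to that strip, and by the symmetries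
to every strip `(mπ/2, (m+1)π/2) × ℝ`; the section at (`n = e₀ + e₁`, `ξ = e₁ - e₀`) does the same on
the strips shifted by `π/4`; the pieces agree on real intervals, hence on overlaps: `p` is ENTIRE.
Nevanlinna (`nevanlinna_representation_holds`, PROVED in tree; Schwarz reflection since `F` is real on
`(0,∞)`): `|F(s)| ≤ C(1 + 1/|Im s|)` near `s = -1`, and `cot²(x+iy) = -1 - 4e^{2ix}e^{-2|y|} + …` gives
`sup_x |p(x+iy)| ≤ C e^{(2+α)|y|}` (near the lines of one family use the other family's bound).  Contour
shift (`Literature.Analysis.Complex.PeriodicEntireFourier.norm_coeff_le_of_periodic_entire` pattern): the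
Fourier coefficient of `e^{2iℓχ}` vanishes for `2|ℓ| > 2 + α`, i.e. `|ℓ| ≥ 2` BECAUSE `α < 2`;
`p = c₀ + a cos 2χ` and `p(π/2 - χ) = p(χ)` forces `a = 0`.  Uses RP through the two Pick sections and
the diagonal mirrors `e₀ ± e₁` (Disproof `not_invarianceOnlyRigidity`, §T(2)); sharp at `α = 2` (§L(i)). -/
theorem Holds.stub_coordinateCircleConstancy :
    ∀ (α : ℝ) (Φ ψ : EuclideanSpace ℝ (Fin 3) → ℝ),
    ψ = (fun k => ∫ z, (1 - Real.cos (inner ℝ k z)) * (‖z‖ ^ (-(3 + α)) * Φ (‖z‖⁻¹ • z))) →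
    1 ≤ α → α < 2 → ContinuousOn Φ (Metric.sphere 0 1) →
    (∀ u ∈ Metric.sphere (0 : EuclideanSpace ℝ (Fin 3)) 1, 0 ≤ Φ u) →
    (∃ u ∈ Metric.sphere (0 : EuclideanSpace ℝ (Fin 3)) 1, 0 < Φ u) → (∀ u, Φ (-u) = Φ u) →
    Continuous ψ → (∀ k, k ≠ 0 → 0 < ψ k) → (∀ c : ℝ, 0 < c → ∀ k, ψ (c • k) = c ^ α * ψ k) →
    (∀ n : EuclideanSpace ℝ (Fin 3), (∃ i j : Fin 3, i ≠ j ∧ (n = EuclideanSpace.single i 1 ∨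
        n = EuclideanSpace.single i 1 + EuclideanSpace.single j 1 ∨
        n = EuclideanSpace.single i 1 - EuclideanSpace.single j 1)) →
      (∀ k, ψ (((ℝ ∙ n)ᗮ).reflection k) = ψ k) ∧
      ∀ ξ : EuclideanSpace ℝ (Fin 3), inner ℝ ξ n = 0 → ∃ F : ℂ → ℂ,
        DifferentiableOn ℂ F Complex.slitPlane ∧ (∀ z : ℂ, 0 < z.im → 0 ≤ (F z).im) ∧
        ∀ s : ℝ, 0 < s → F (s : ℂ) = ((ψ (Real.sqrt s • n + ξ) : ℝ) : ℂ)) →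
    ∀ k : EuclideanSpace ℝ (Fin 3), k 2 = 0 → ‖k‖ = 1 →
      ψ k = ψ (EuclideanSpace.single (0 : Fin 3) (1 : ℝ)) := by
  sorry

/-- **stub_jointAnalyticity** (size L–XL; card `cross-theorem-analyticity` folded in as the local rung;
Disproof §G "LOCAL step is fine", triage r1-2/3).  With the same data: `ψ` is real-analytic on `ℝ³ ∖ 0`
(equivalently `g = ψ/‖k‖^α ∈ C^ω(S²)`).  Mechanism: for each pole `n` among the nine normals and each
`ξ̂ ∈ n⊥ ∩ S²` the Pick section gives, through `s = cot²χ`, a holomorphic extension of the meridian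
profile `χ ↦ g(cos χ n̂ + sin χ ξ̂)` to the full strip `0 < Re χ < π/2` with bounds uniform in `ξ̂`
(`|F(i)| ≤ √2 F(1) ≤ 2 max ψ` on the sphere of radius `√2`); at every point of `S²` two of the nine
pencils have the point off their pole/equator sets and transversal meridians there (a plane contains at
most four of the nine normal directions; checked for generic points, points of the seven-circle net, the
18 poles, the body diagonals), so after the real-analytic straightening of the two meridian foliations
the Bernstein–Siciak separate-analyticity (cross) theorem with uniform strips and bounds gives joint
analyticity; `‖k‖^α = (‖k‖²)^{α/2}` is analytic off `0`.  Leans on: Siciak 1969 (Ann. Polon. Math. 22)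
/ real-analytic cross theorem (doi:10.1007/s41478-025-00942-5) — NOT in tree (to be filed as a Literature
named fact); `Literature.Analysis.Complex.OsgoodSeparate` / `Osgood` (PROVED) for the complex step after a
first Bernstein estimate; triage r1-2 warns: use the cross theorem for functions defined only on the
cross, not Osgood directly. -/
theorem Holds.stub_jointAnalyticity :
    ∀ (α : ℝ) (Φ ψ : EuclideanSpace ℝ (Fin 3) → ℝ),
    ψ = (fun k => ∫ z, (1 - Real.cos (inner ℝ k z)) * (‖z‖ ^ (-(3 + α)) * Φ (‖z‖⁻¹ • z))) →
    1 ≤ α → α < 2 → ContinuousOn Φ (Metric.sphere 0 1) →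
    (∀ u ∈ Metric.sphere (0 : EuclideanSpace ℝ (Fin 3)) 1, 0 ≤ Φ u) →
    (∃ u ∈ Metric.sphere (0 : EuclideanSpace ℝ (Fin 3)) 1, 0 < Φ u) → (∀ u, Φ (-u) = Φ u) →
    Continuous ψ → (∀ k, k ≠ 0 → 0 < ψ k) → (∀ c : ℝ, 0 < c → ∀ k, ψ (c • k) = c ^ α * ψ k) →
    (∀ n : EuclideanSpace ℝ (Fin 3), (∃ i j : Fin 3, i ≠ j ∧ (n = EuclideanSpace.single i 1 ∨
        n = EuclideanSpace.single i 1 + EuclideanSpace.single j 1 ∨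
        n = EuclideanSpace.single i 1 - EuclideanSpace.single j 1)) →
      (∀ k, ψ (((ℝ ∙ n)ᗮ).reflection k) = ψ k) ∧
      ∀ ξ : EuclideanSpace ℝ (Fin 3), inner ℝ ξ n = 0 → ∃ F : ℂ → ℂ,
        DifferentiableOn ℂ F Complex.slitPlane ∧ (∀ z : ℂ, 0 < z.im → 0 ≤ (F z).im) ∧
        ∀ s : ℝ, 0 < s → F (s : ℂ) = ((ψ (Real.sqrt s • n + ξ) : ℝ) : ℂ)) →
    AnalyticOnNhd ℝ ψ {0}ᶜ := by
  sorry

/-- **stub_transversalJetFlatness** (size XL; THE CLOSER and the line's residual bet; HARDEST).  With the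
same data, analyticity (previous stub) and constancy of `ψ` on the unit circle of `{k₂ = 0}` (the lever's
output = order `0`): every transversal jet of `ψ` across that circle is constant along it —
`∂ₜʲ|₀ ψ(cos ω e₀ + sin ω e₁ + t e₂)` does not depend on `ω`, for every `j`.  Odd `j`: zero by the mirror
`e₂`.  `j = 2`: Disproof §V PROPOSITION (paper, all exponents written): the second normal derivative
`G₂(ω)` continues (cross theorem on segment × strip, Cauchy loss `δ(T) ~ e^{-2|T|}`) to an entire
`π/2`-periodic function of type `≤ 4 + α < 6`, so `G₂ = c₀ + c₁ cos 4ω`, and CBF-positivity of the `e₀`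
sections on the leaves through `(0, cos φ, sin φ)` in the window `φ^{4/(4+α)} ≪ |s+1| ≪ φ^{2/3}`
(non-empty iff `α < 2`: phase sweep `> 2π`) kills `c₁`.  General `j = 2k`: the same template allows modes
`cos 4iω`, `4i ≤ 2 + α + 2k`; §V(ii): odd `k` have a positivity window, EVEN `k` ARE MARGINAL with the
`e^{-2|T|}` transversal estimate — the honest stuck point (first open case `j = 4`).  Two ways in, both
recorded by the panel: (a) sharper transversal reach — triage r1-3's triple-cross hull computation gives
leafwise continuation of `g` on the `e₀`-leaf through `u_φ` up to height `artanh(cos φ) → ∞` at the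
circle; a Cauchy loss `δ(T) ~ e^{-c|T|}` with `c ≤ 1` would bound EVERY jet by type `2 + α < 4` and kill
all its modes with no positivity at all (growth alone, exactly the lever's arithmetic); (b) positivity
across leaves beyond CBF of single sections (`Φ ≥ 0`, i.e. `e^{-ψ}` positive definite — available here
because `ψ` is given as `ψ_Φ` with `Φ` admissible; unused so far, the card's reserve input).  Truth
value: implied by the crux (radial `ψ` has flat jets) and implies it given the next stub, so this IS where
the crux lives; it is not a restatement: it is local at the net, graded by `j`, with `j ≤ 3` settled on
paper.  Honours Disproof §G (no global envelope claimed) and §P(iii) (milestones: local analyticity, §L,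
§V). -/
theorem Holds.stub_transversalJetFlatness :
    ∀ (α : ℝ) (Φ ψ : EuclideanSpace ℝ (Fin 3) → ℝ),
    ψ = (fun k => ∫ z, (1 - Real.cos (inner ℝ k z)) * (‖z‖ ^ (-(3 + α)) * Φ (‖z‖⁻¹ • z))) →
    1 ≤ α → α < 2 → ContinuousOn Φ (Metric.sphere 0 1) →
    (∀ u ∈ Metric.sphere (0 : EuclideanSpace ℝ (Fin 3)) 1, 0 ≤ Φ u) →
    (∃ u ∈ Metric.sphere (0 : EuclideanSpace ℝ (Fin 3)) 1, 0 < Φ u) → (∀ u, Φ (-u) = Φ u) →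
    Continuous ψ → (∀ k, k ≠ 0 → 0 < ψ k) → (∀ c : ℝ, 0 < c → ∀ k, ψ (c • k) = c ^ α * ψ k) →
    (∀ n : EuclideanSpace ℝ (Fin 3), (∃ i j : Fin 3, i ≠ j ∧ (n = EuclideanSpace.single i 1 ∨
        n = EuclideanSpace.single i 1 + EuclideanSpace.single j 1 ∨
        n = EuclideanSpace.single i 1 - EuclideanSpace.single j 1)) →
      (∀ k, ψ (((ℝ ∙ n)ᗮ).reflection k) = ψ k) ∧
      ∀ ξ : EuclideanSpace ℝ (Fin 3), inner ℝ ξ n = 0 → ∃ F : ℂ → ℂ,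
        DifferentiableOn ℂ F Complex.slitPlane ∧ (∀ z : ℂ, 0 < z.im → 0 ≤ (F z).im) ∧
        ∀ s : ℝ, 0 < s → F (s : ℂ) = ((ψ (Real.sqrt s • n + ξ) : ℝ) : ℂ)) →
    AnalyticOnNhd ℝ ψ {0}ᶜ →
    (∀ k : EuclideanSpace ℝ (Fin 3), k 2 = 0 → ‖k‖ = 1 →
      ψ k = ψ (EuclideanSpace.single (0 : Fin 3) (1 : ℝ))) →
    ∀ (j : ℕ) (ω ω' : ℝ),
      iteratedDeriv j (fun t : ℝ => ψ (Real.cos ω • EuclideanSpace.single (0 : Fin 3) (1 : ℝ) +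
        Real.sin ω • EuclideanSpace.single (1 : Fin 3) (1 : ℝ) +
        t • EuclideanSpace.single (2 : Fin 3) (1 : ℝ))) 0 =
      iteratedDeriv j (fun t : ℝ => ψ (Real.cos ω' • EuclideanSpace.single (0 : Fin 3) (1 : ℝ) +
        Real.sin ω' • EuclideanSpace.single (1 : Fin 3) (1 : ℝ) +
        t • EuclideanSpace.single (2 : Fin 3) (1 : ℝ))) 0 := by
  sorry

/-- **stub_radialOfFlatJets** (size M; the finish, elementary real-analytic geometry).  With the same
data, analyticity and flat transversal jets across the circle `{k₂ = 0}`: `ψ` is `O(3)`-invariant.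
Proof: for fixed `ω` the function `t ↦ ψ(u_ω + t e₂)` (`u_ω = cos ω e₀ + sin ω e₁`) is real-analytic on
`ℝ`; its Taylor coefficients at `0` do not depend on `ω`, so on the common interval of convergence
`|t| < ρ` it equals one power series `G(t)` for every `ω` (identity theorem on an interval); by
homogeneity `ψ(k) = (k₀² + k₁²)^{α/2} G(k₂/√(k₀² + k₁²))` on the open cone `|k₂| < ρ √(k₀² + k₁²)`; the
swap `k₀ ↔ k₂` (mirror `e₀ - e₂`, one of the nine) evaluated at `(0, 1, b)` gives
`G(b) = (1 + b²)^{α/2} G(0)`, so `ψ = G(0)‖k‖^α` on the cone, hence on the connected set `ℝ³ ∖ 0` by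
analytic continuation (`AnalyticOnNhd.eqOn_of_preconnected_of_eventuallyEq`,
`isConnected_compl_singleton_of_one_lt_rank`), and trivially at `0`.  Uses only homogeneity, the swap
mirror, analyticity and the jets (continuity/positivity/Pick are carried for uniformity of the chain). -/
theorem Holds.stub_radialOfFlatJets :
    ∀ (α : ℝ) (Φ ψ : EuclideanSpace ℝ (Fin 3) → ℝ),
    ψ = (fun k => ∫ z, (1 - Real.cos (inner ℝ k z)) * (‖z‖ ^ (-(3 + α)) * Φ (‖z‖⁻¹ • z))) →
    1 ≤ α → α < 2 → ContinuousOn Φ (Metric.sphere 0 1) →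
    (∀ u ∈ Metric.sphere (0 : EuclideanSpace ℝ (Fin 3)) 1, 0 ≤ Φ u) →
    (∃ u ∈ Metric.sphere (0 : EuclideanSpace ℝ (Fin 3)) 1, 0 < Φ u) → (∀ u, Φ (-u) = Φ u) →
    Continuous ψ → (∀ k, k ≠ 0 → 0 < ψ k) → (∀ c : ℝ, 0 < c → ∀ k, ψ (c • k) = c ^ α * ψ k) →
    (∀ n : EuclideanSpace ℝ (Fin 3), (∃ i j : Fin 3, i ≠ j ∧ (n = EuclideanSpace.single i 1 ∨
        n = EuclideanSpace.single i 1 + EuclideanSpace.single j 1 ∨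
        n = EuclideanSpace.single i 1 - EuclideanSpace.single j 1)) →
      (∀ k, ψ (((ℝ ∙ n)ᗮ).reflection k) = ψ k) ∧
      ∀ ξ : EuclideanSpace ℝ (Fin 3), inner ℝ ξ n = 0 → ∃ F : ℂ → ℂ,
        DifferentiableOn ℂ F Complex.slitPlane ∧ (∀ z : ℂ, 0 < z.im → 0 ≤ (F z).im) ∧
        ∀ s : ℝ, 0 < s → F (s : ℂ) = ((ψ (Real.sqrt s • n + ξ) : ℝ) : ℂ)) →
    AnalyticOnNhd ℝ ψ {0}ᶜ →
    (∀ (j : ℕ) (ω ω' : ℝ),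
      iteratedDeriv j (fun t : ℝ => ψ (Real.cos ω • EuclideanSpace.single (0 : Fin 3) (1 : ℝ) +
        Real.sin ω • EuclideanSpace.single (1 : Fin 3) (1 : ℝ) +
        t • EuclideanSpace.single (2 : Fin 3) (1 : ℝ))) 0 =
      iteratedDeriv j (fun t : ℝ => ψ (Real.cos ω' • EuclideanSpace.single (0 : Fin 3) (1 : ℝ) +
        Real.sin ω' • EuclideanSpace.single (1 : Fin 3) (1 : ℝ) +
        t • EuclideanSpace.single (2 : Fin 3) (1 : ℝ))) 0) →
    ∀ (R : EuclideanSpace ℝ (Fin 3) ≃ₗᵢ[ℝ] EuclideanSpace ℝ (Fin 3)) (k : EuclideanSpace ℝ (Fin 3)),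
      ψ (R k) = ψ k := by
  sorry

/-- **stub_kernelIsotropyOfRadialSymbol** (size L; the converse dictionary, Disproof §0 "K is UNIQUELY
determined by (α, Φ): K̂ = 1/ψ_Φ").  Under the crux hypotheses on `(α, Φ, K)` (no mirror hypothesis
needed): if the Lévy exponent `ψ_Φ` is `O(3)`-invariant then so is `K`.  Mechanism: `K` is locally
integrable of degree `α - 3 > -3`, tempered; the potential equation says `K̂ · ψ_Φ · f̂ = f̂` for all test
`f`, so `K̂ = 1/ψ_Φ` off `0`; for a linear isometry `R`, `K ∘ R` has Fourier transform `K̂ ∘ R = K̂`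
(`ψ_Φ ∘ R = ψ_Φ`), and two tempered solutions differ by a distribution with Fourier support `{0}`, a
polynomial, homogeneous of negative degree, hence `0`.  Leans on: Mathlib `SchwartzMap.fourierTransformCLM`,
tree `Literature.Analysis.Distribution.FourierSupportAtZero` / `FourierSupportAtZeroConst` /
`Literature.Analysis.Fourier.ConstOfFourierSupportZero`; the engine `K̂ = 1/ψ_Φ` is shared with
`stub_symbolDictionary` (file it once as a `--supports` helper).  Alternative route: `ψ_Φ` radial ⇒ `Φ`
constant (injectivity of the order-`α` cosine transform on even functions, `α ∉ 2ℕ`, Funk–Hecke) ⇒ `L_Φ`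
commutes with rotations ⇒ `K ∘ R` solves the same potential equation ⇒ uniqueness. -/
theorem Holds.stub_kernelIsotropyOfRadialSymbol :
    ∀ (α : ℝ) (Φ K ψ : EuclideanSpace ℝ (Fin 3) → ℝ),
    ψ = (fun k => ∫ z, (1 - Real.cos (inner ℝ k z)) * (‖z‖ ^ (-(3 + α)) * Φ (‖z‖⁻¹ • z))) →
    1 ≤ α → α < 2 → ContinuousOn Φ (Metric.sphere 0 1) →
    (∀ u ∈ Metric.sphere (0 : EuclideanSpace ℝ (Fin 3)) 1, 0 ≤ Φ u) →
    (∃ u ∈ Metric.sphere (0 : EuclideanSpace ℝ (Fin 3)) 1, 0 < Φ u) → (∀ u, Φ (-u) = Φ u) →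
    ContinuousOn K {0}ᶜ → (∀ x, x ≠ 0 → 0 < K x) →
    (∀ c : ℝ, 0 < c → ∀ x, K (c • x) = c ^ (α - 3) * K x) →
    (∀ f : EuclideanSpace ℝ (Fin 3) → ℝ, ContDiff ℝ 2 f → HasCompactSupport f → ∀ x,
      (∫ y, K (x - y) * ((1/2 : ℝ) * ∫ z, (f (y + z) + f (y - z) - 2 * f y) *
        (‖z‖ ^ (-(3 + α)) * Φ (‖z‖⁻¹ • z)))) = - f x) →
    (∀ (R : EuclideanSpace ℝ (Fin 3) ≃ₗᵢ[ℝ] EuclideanSpace ℝ (Fin 3)) (k : EuclideanSpace ℝ (Fin 3)),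
      ψ (R k) = ψ k) →
    ∀ (R : EuclideanSpace ℝ (Fin 3) ≃ₗᵢ[ℝ] EuclideanSpace ℝ (Fin 3)) (x : EuclideanSpace ℝ (Fin 3)),
      K (R x) = K x := by
  sorry

/-! ### By-name handles of the six statements (no second copy of the text) -/

/-- Statement of registered stub 1 (`Holds.stub_symbolDictionary`), by name. -/
def stub_symbolDictionary : Prop := type_of% Holds.stub_symbolDictionary

/-- Statement of registered stub 2 (`Holds.stub_coordinateCircleConstancy`), by name. -/
def stub_coordinateCircleConstancy : Prop := type_of% Holds.stub_coordinateCircleConstancy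

/-- Statement of registered stub 3 (`Holds.stub_jointAnalyticity`), by name. -/
def stub_jointAnalyticity : Prop := type_of% Holds.stub_jointAnalyticity

/-- Statement of registered stub 4 (`Holds.stub_transversalJetFlatness`), by name. -/
def stub_transversalJetFlatness : Prop := type_of% Holds.stub_transversalJetFlatness

/-- Statement of registered stub 5 (`Holds.stub_radialOfFlatJets`), by name. -/
def stub_radialOfFlatJets : Prop := type_of% Holds.stub_radialOfFlatJets

/-- Statement of registered stub 6 (`Holds.stub_kernelIsotropyOfRadialSymbol`), by name. -/
def stub_kernelIsotropyOfRadialSymbol : Prop := type_of% Holds.stub_kernelIsotropyOfRadialSymbol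

/-! ## §2 Composition (sorry-free): the six stubs give the crux BY NAME -/

/-- **`stub_symbolDictionary → stub_coordinateCircleConstancy → stub_jointAnalyticity →
stub_transversalJetFlatness → stub_radialOfFlatJets → stub_kernelIsotropyOfRadialSymbol →
PrecisionLaplacian.StableConeRPRigidity`** (kernel-checked, pure logic): feed the crux hypotheses to
the dictionary; its four outputs (continuity, positivity, homogeneity, mirror-wise invariance + Pick
sections of `ψ_Φ`, specialised to the nine normals using the crux's mirror clause) feed the lever, the
analyticity rung, the closer and the finish in a chain; the radial symbol feeds the converse dictionary. -/
theorem StableConeRPRigidity_of (h₁ : stub_symbolDictionary) (h₂ : stub_coordinateCircleConstancy)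
    (h₃ : stub_jointAnalyticity) (h₄ : stub_transversalJetFlatness) (h₅ : stub_radialOfFlatJets)
    (h₆ : stub_kernelIsotropyOfRadialSymbol) :
    Summit.CriticalPhenomena.Ising3DConformalLimit.Theses.PrecisionLaplacian.StableConeRPRigidity := by
  intro α Φ K hα1 hα2 hΦc hΦnn hΦpos hΦev hKc hKp hhom hpot hmir R x
  obtain ⟨hψc, hψp, hψh, hψn⟩ := h₁ α Φ K _ rfl hα1 hα2 hΦc hΦnn hΦpos hΦev hKc hKp hhom hpot
  have hweb := h₂ α Φ _ rfl hα1 hα2 hΦc hΦnn hΦpos hΦev hψc hψp hψh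
    (fun n hn => hψn n (hmir n hn).1 (hmir n hn).2)
  have han := h₃ α Φ _ rfl hα1 hα2 hΦc hΦnn hΦpos hΦev hψc hψp hψh
    (fun n hn => hψn n (hmir n hn).1 (hmir n hn).2)
  have hjet := h₄ α Φ _ rfl hα1 hα2 hΦc hΦnn hΦpos hΦev hψc hψp hψh
    (fun n hn => hψn n (hmir n hn).1 (hmir n hn).2) han hweb
  have hrad := h₅ α Φ _ rfl hα1 hα2 hΦc hΦnn hΦpos hΦev hψc hψp hψh
    (fun n hn => hψn n (hmir n hn).1 (hmir n hn).2) han hjet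
  exact h₆ α Φ K _ rfl hα1 hα2 hΦc hΦnn hΦpos hΦev hKc hKp hhom hpot hrad R x

/-- D-0027 §3.3 shape: the crux from the registered stubs (an `example`, so that
`StableConeRPRigidity_of` stays the unique theorem concluding the crux; it becomes a proof once the six
`sorry`s are discharged). -/
example : Summit.CriticalPhenomena.Ising3DConformalLimit.Theses.PrecisionLaplacian.StableConeRPRigidity :=
  StableConeRPRigidity_of Holds.stub_symbolDictionary Holds.stub_coordinateCircleConstancy
    Holds.stub_jointAnalyticity Holds.stub_transversalJetFlatness Holds.stub_radialOfFlatJets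
    Holds.stub_kernelIsotropyOfRadialSymbol

end Summit.CriticalPhenomena.Ising3DConformalLimit.Cruxes.StableConeRPRigidity.PickHalfStripEntireProfile

end
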